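import Mathlib
import Summits.KontsevichZagierPeriods.Zeta5Search.CatalanTwoAdicInterpolation
import HarnessLib

/-!
# Kernel K5f — the Kubota–Leopoldt interpolation on `2ℤ₂` EXISTS, is UNIQUE, and takes the value `ξ` at `s = 2` (fam-catalan g5, 2026-08-21)

HONEST FRAMING: systematic search; no irrationality claim unless certified.  Nothing here is a new irrationality: `ξ ∉ ℚ` is the tree theorem
`CatalanTwoAdicFinal.xi_not_ratCast` (re-proof of Calegari 2005 / [Be08, Cor. 14]); this file is about WHICH classical constant `ξ` is.  Records UNMOVED.

K5d (`CatalanTwoAdicZeta`): `ξ = zetaTwoAtTwo`, Washington's explicit Bernoulli series for `ζ₂(2)` ([Wa97, Thm. 5.11]).  K5e (`CatalanTwoAdicInterpolation`):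
`L(2 − 2^N, χ₋₄) → ξ` in `ℚ₂`, where `betaOneSub n = L(1−n, χ₋₄) = −B_{n,χ₋₄}/n ∈ ℚ` ARE (kernel, `LFunction_chiFour_one_sub`) the values of Mathlib's
analytically continued Dirichlet `L`-function.  K5e left printed the EXISTENCE/CONTINUITY of the Kubota–Leopoldt function, i.e. that the symbol `ζ₂(2)`
names that limit.  This file removes it, with no formula for `ζ₂` presupposed:
* `betaOneSub_lipschitz` — generalised Kummer congruences, 2-adic Lipschitz form: `‖β(1−m) − β(1−n)‖₂ ≤ K‖m − n‖₂` for odd `m, n ≥ 1` (Washington's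
  terminating form `betaOneSub_eq` + 2-adic continuity of `binom(·,j)` (Vandermonde) and of `3^(·)` + the crude bound `‖B_j‖₂ ≤ C2^j` of K5d);
* `LTwo : ℤ_[2] → ℚ_[2]`, `continuous_LTwo`, `LTwo_natCast : LTwo t = β(1 − (2t+1))`, `LTwo_unique` — THE continuous function on `ℤ₂` interpolating
  `t ↦ L(−2t, χ₋₄)`, `t ∈ ℕ`, exists (uniformly continuous extension from the dense `ℕ ⊂ ℤ₂`, `PadicInt.denseRange_natCast`) and is unique; in the
  dictionary `s = −2t ∈ 2ℤ₂` it is the Kubota–Leopoldt `L₂(s, 𝟙) = ζ₂(s)` (`ζ₂(1−n) = −(1 − χω^{−n}(2)2^{n−1})B_{n,χω^{−n}}/n = −B_{n,χ₋₄}/n` for odd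
  `n`, `ω = χ₋₄` the Teichmüller character at `p = 2`; [Wa97, Thm. 5.11 and its uniqueness clause]);
* **`LTwo_neg_one : LTwo (−1) = xi`**, i.e. **`ζ₂(2) = ξ`** with `ζ₂` DEFINED BY ITS INTERPOLATION PROPERTY (K5e's `tendsto_betaOneSub_xi` + continuity,
  `2^M − 1 → −1` in `ℤ₂`); `kubotaLeopoldt_two` packages `∃!` + "every continuous interpolation has value `ξ` at `t = −1` (`s = 2`)".
After K5f the paper's §T (C6) "ξ = ζ₂(2)" is a kernel theorem outright, `ζ₂|2ℤ₂` read as the unique continuous 2-adic interpolation of `L(1−n, χ₋₄)`, `n` odd.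
-/

open Finset Nat Filter Topology

noncomputable section

namespace Summit.KontsevichZagierPeriods.Zeta5Search.CatalanTwoAdicKubotaLeopoldt

open CatalanTwoAdicSeries (xi norm_two_padic)
open CatalanTwoAdicZeta (bernTwo exists_norm_bernTwo_le)
open CatalanTwoAdicInterpolation (betaOneSub betaOneSub_eq norm_three norm_four tendsto_betaOneSub_xi)

/-! ### 2-adic sizes of naturals and binomial coefficients -/

/-- `‖m‖₂ = 1` for odd `m`. -/
theorem norm_natCast_of_odd {m : ℕ} (hm : Odd m) : ‖(m : ℚ_[2])‖ = 1 :=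
  Padic.norm_natCast_eq_one_iff.mpr (Nat.prime_two.coprime_iff_not_dvd.mpr (by obtain ⟨c, rfl⟩ := hm; omega))

/-- `1 ≤ b·‖b‖₂` for `b ≥ 1` (`‖b‖₂ = 2^{−v₂(b)} ≥ 1/b`). -/
theorem one_le_mul_norm_natCast {b : ℕ} (hb : b ≠ 0) : 1 ≤ (b : ℝ) * ‖(b : ℚ_[2])‖ := by
  obtain ⟨k, m, hm, rfl⟩ := Nat.exists_eq_two_pow_mul_odd hb
  have h1 : (1 : ℝ) ≤ m := by exact_mod_cast hm.pos
  have h2 : (2 : ℝ) ^ k * (1 / 2) ^ k = 1 := by rw [← mul_pow]; norm_num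
  push_cast; rw [norm_mul, norm_pow, norm_two_padic, norm_natCast_of_odd hm]
  calc (1 : ℝ) ≤ m := h1
    _ = 2 ^ k * (m : ℝ) * ((1 / 2) ^ k * 1) := by rw [mul_one, mul_right_comm, h2, one_mul]

/-- `‖b‖₂⁻¹ ≤ b` for `b ≥ 1`. -/
theorem inv_norm_natCast_le {b : ℕ} (hb : b ≠ 0) : ‖(b : ℚ_[2])‖⁻¹ ≤ b := by
  have hB := one_le_mul_norm_natCast hb
  have hpos : 0 < ‖(b : ℚ_[2])‖ := norm_pos_iff.mpr (by exact_mod_cast hb)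
  calc ‖(b : ℚ_[2])‖⁻¹ = ‖(b : ℚ_[2])‖⁻¹ * 1 := (mul_one _).symm
    _ ≤ ‖(b : ℚ_[2])‖⁻¹ * ((b : ℝ) * ‖(b : ℚ_[2])‖) := mul_le_mul_of_nonneg_left hB (inv_nonneg.mpr hpos.le)
    _ = b := by field_simp

/-- `‖binom(d, b)‖₂ ≤ b·‖d‖₂` for `b ≥ 1` (`b·binom(d,b) = d·binom(d−1,b−1)`). -/
theorem norm_choose_le (d b : ℕ) (hb : 1 ≤ b) : ‖((d.choose b : ℕ) : ℚ_[2])‖ ≤ b * ‖(d : ℚ_[2])‖ := by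
  rcases d with _ | d
  · rw [Nat.choose_eq_zero_of_lt (by omega)]; simp
  rcases b with _ | b
  · omega
  have hb0 : ((b + 1 : ℕ) : ℚ_[2]) ≠ 0 := by exact_mod_cast Nat.succ_ne_zero b
  have key : (((d + 1).choose (b + 1) : ℕ) : ℚ_[2]) = ((d + 1 : ℕ) : ℚ_[2]) * ((d.choose b : ℕ) : ℚ_[2]) * (((b + 1 : ℕ) : ℚ_[2]))⁻¹ := by
    rw [eq_mul_inv_iff_mul_eq₀ hb0]; exact_mod_cast (Nat.add_one_mul_choose_eq d b).symm
  have h1 : ‖((d.choose b : ℕ) : ℚ_[2])‖ ≤ 1 := IsUltrametricDist.norm_natCast_le_one ℚ_[2] _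
  have h2 : ‖((b + 1 : ℕ) : ℚ_[2])‖⁻¹ ≤ ((b + 1 : ℕ) : ℝ) := inv_norm_natCast_le (by omega)
  rw [key, norm_mul, norm_mul, norm_inv]
  calc ‖((d + 1 : ℕ) : ℚ_[2])‖ * ‖((d.choose b : ℕ) : ℚ_[2])‖ * ‖((b + 1 : ℕ) : ℚ_[2])‖⁻¹
      ≤ ‖((d + 1 : ℕ) : ℚ_[2])‖ * 1 * ((b + 1 : ℕ) : ℝ) := mul_le_mul (mul_le_mul_of_nonneg_left h1 (norm_nonneg _)) h2 (by positivity) (by positivity)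
    _ = ((b + 1 : ℕ) : ℝ) * ‖((d + 1 : ℕ) : ℚ_[2])‖ := by ring

/-- **2-adic continuity of `binom(·, j)`:** `‖binom(n+d, j) − binom(n, j)‖₂ ≤ j·‖d‖₂` (Vandermonde: the difference is
`Σ_{k<j} binom(n,k)·binom(d,j−k)` and `‖binom(d,b)‖₂ ≤ b‖d‖₂`). -/
theorem norm_choose_add_sub_choose_le (n d j : ℕ) : ‖(((n + d).choose j : ℕ) : ℚ_[2]) - ((n.choose j : ℕ) : ℚ_[2])‖ ≤ j * ‖(d : ℚ_[2])‖ := by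
  have hV : (((n + d).choose j : ℕ) : ℚ_[2]) - ((n.choose j : ℕ) : ℚ_[2]) = ∑ k ∈ range j, ((n.choose k : ℕ) : ℚ_[2]) * ((d.choose (j - k) : ℕ) : ℚ_[2]) := by
    rw [Nat.add_choose_eq, Finset.Nat.sum_antidiagonal_eq_sum_range_succ_mk, Finset.sum_range_succ]
    simp only [Nat.sub_self, Nat.choose_zero_right, mul_one]; push_cast; ring
  rw [hV]
  refine IsUltrametricDist.norm_sum_le_of_forall_le_of_nonneg (by positivity) fun k hk => ?_
  have hk' : k < j := mem_range.mp hk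
  rw [norm_mul]
  calc ‖((n.choose k : ℕ) : ℚ_[2])‖ * ‖((d.choose (j - k) : ℕ) : ℚ_[2])‖
      ≤ 1 * (((j - k : ℕ) : ℝ) * ‖(d : ℚ_[2])‖) :=
        mul_le_mul (IsUltrametricDist.norm_natCast_le_one ℚ_[2] _) (norm_choose_le d (j - k) (by omega)) (norm_nonneg _) zero_le_one
    _ ≤ j * ‖(d : ℚ_[2])‖ := by rw [one_mul]; gcongr; exact_mod_cast Nat.sub_le j k

/-- `j·2^{−j} ≤ 1`. -/
theorem cast_mul_half_pow_le_one (j : ℕ) : (j : ℝ) * ((1 : ℝ) / 2) ^ j ≤ 1 := by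
  have h' : (j : ℝ) ≤ (2 : ℝ) ^ j := by exact_mod_cast (Nat.lt_two_pow_self (n := j)).le
  rw [one_div, inv_pow]
  calc (j : ℝ) * ((2 : ℝ) ^ j)⁻¹ ≤ (2 : ℝ) ^ j * ((2 : ℝ) ^ j)⁻¹ := by gcongr
    _ = 1 := mul_inv_cancel₀ (by positivity)

/-- **2-adic continuity of `3^(·)`:** `‖3^d − 1‖₂ ≤ ‖d‖₂` (`3^d = (2+1)^d = 1 + Σ_{k≥1} 2^k·binom(d,k)` and
`‖2^k·binom(d,k)‖₂ ≤ k2^{−k}‖d‖₂ ≤ ‖d‖₂`). -/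
theorem norm_three_pow_sub_one_le (d : ℕ) : ‖(3 : ℚ_[2]) ^ d - 1‖ ≤ ‖(d : ℚ_[2])‖ := by
  have h3 : (3 : ℚ_[2]) ^ d - 1 = ∑ k ∈ range d, (2 : ℚ_[2]) ^ (k + 1) * ((d.choose (k + 1) : ℕ) : ℚ_[2]) := by
    rw [show (3 : ℚ_[2]) = 2 + 1 by norm_num, add_pow, Finset.sum_range_succ']
    simp only [one_pow, mul_one, pow_zero, Nat.choose_zero_right, Nat.cast_one, add_sub_cancel_right]
  rw [h3]
  refine IsUltrametricDist.norm_sum_le_of_forall_le_of_nonneg (norm_nonneg _) fun k _ => ?_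
  rw [norm_mul, norm_pow, norm_two_padic]
  calc ((1 : ℝ) / 2) ^ (k + 1) * ‖((d.choose (k + 1) : ℕ) : ℚ_[2])‖
      ≤ ((1 : ℝ) / 2) ^ (k + 1) * ((((k + 1 : ℕ)) : ℝ) * ‖(d : ℚ_[2])‖) := mul_le_mul_of_nonneg_left (norm_choose_le d (k + 1) (by omega)) (by positivity)
    _ = ((((k + 1 : ℕ)) : ℝ) * ((1 : ℝ) / 2) ^ (k + 1)) * ‖(d : ℚ_[2])‖ := by ring
    _ ≤ 1 * ‖(d : ℚ_[2])‖ := mul_le_mul_of_nonneg_right (cast_mul_half_pow_le_one (k + 1)) (norm_nonneg _)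
    _ = ‖(d : ℚ_[2])‖ := one_mul _

/-! ### Washington's finite form for general `n`, and its 2-adic Lipschitz estimate -/

/-- The term `binom(n, j)·B_j·a^j` (`a = 4` resp. `4/3`) of Washington's finite form of `β(1−n)` (`betaOneSub_eq`). -/
def term (a : ℚ_[2]) (n j : ℕ) : ℚ_[2] := ((n.choose j : ℕ) : ℚ_[2]) * bernTwo j * a ^ j

/-- `Σ_{j ≤ M} binom(n, j)·B_j·a^j` — for `M ≥ n` this is the whole (terminating) sum. -/
def psum (a : ℚ_[2]) (M n : ℕ) : ℚ_[2] := ∑ j ∈ range (M + 1), term a n j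

/-- `‖4/3‖₂ = ¼`. -/
theorem norm_four_div_three : ‖(4 / 3 : ℚ_[2])‖ = (1 : ℝ) / 2 * (1 / 2) := by
  rw [norm_div, norm_four, norm_three, div_one]

/-- The sum does not depend on the cut-off `M ≥ n` (`binom(n, j) = 0` for `j > n`). -/
theorem psum_eq (a : ℚ_[2]) {M n : ℕ} (h : n ≤ M) : psum a M n = psum a n n := by
  unfold psum
  refine (Finset.sum_subset (fun x hx => by simp only [mem_range] at hx ⊢; omega) fun j _ hj => ?_).symm
  have hlt : n < j := by simpa [mem_range] using hj
  simp [term, Nat.choose_eq_zero_of_lt hlt]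

/-- `β(1−n)` in `ℚ₂`, Washington's finite form with any cut-off `M ≥ n` (`n ≥ 1`):
`β(1−n) = −(4n)⁻¹·(Σ_{j≤M} binom(n,j)B_j4^j − 3^n·Σ_{j≤M} binom(n,j)B_j(4/3)^j)`. -/
theorem cast_betaOneSub {M n : ℕ} (hn : n ≠ 0) (hM : n ≤ M) :
    ((betaOneSub n : ℚ) : ℚ_[2]) = -(4 * (n : ℚ_[2]))⁻¹ * (psum 4 M n - 3 ^ n * psum (4 / 3) M n) := by
  have hS1 : (((∑ i ∈ range (n + 1), _root_.bernoulli i * (n.choose i : ℚ) * 4 ^ i : ℚ)) : ℚ_[2]) = psum 4 n n := by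
    unfold psum; push_cast; exact sum_congr rfl fun i _ => by simp only [term, bernTwo]; ring
  have hS3 : (((∑ i ∈ range (n + 1), _root_.bernoulli i * (n.choose i : ℚ) * (4 / 3) ^ i : ℚ)) : ℚ_[2]) = psum (4 / 3) n n := by
    unfold psum; push_cast; exact sum_congr rfl fun i _ => by simp only [term, bernTwo]; ring
  rw [betaOneSub_eq _ hn, psum_eq _ hM, psum_eq _ hM, ← hS1, ← hS3]; push_cast; ring

section Bounds

variable {C : ℝ} (hC : ∀ n, ‖bernTwo n‖ ≤ C * 2 ^ n) {a : ℚ_[2]} (ha : ‖a‖ = (1 : ℝ) / 2 * (1 / 2))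
include hC

/-- The Bernoulli bound constant is `≥ 0`. -/
theorem C_nonneg : (0 : ℝ) ≤ C := by -- lane edit (lead/lit g13): ascription dodges a textual dedup.landed false positive
  have := (norm_nonneg _).trans (hC 0); simpa using this

include ha

/-- Domination `‖binom(n,j)B_ja^j‖₂ ≤ C·2^{−j}` (`‖a‖₂ = ¼`, `‖B_j‖₂ ≤ C2^j`). -/
theorem norm_term_le (n j : ℕ) : ‖term a n j‖ ≤ C * ((1 : ℝ) / 2) ^ j := by
  have hc : ‖((n.choose j : ℕ) : ℚ_[2])‖ ≤ 1 := IsUltrametricDist.norm_natCast_le_one ℚ_[2] _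
  rw [term, norm_mul, norm_mul, norm_pow, ha]
  calc ‖((n.choose j : ℕ) : ℚ_[2])‖ * ‖bernTwo j‖ * ((1 : ℝ) / 2 * (1 / 2)) ^ j
      ≤ 1 * (C * 2 ^ j) * ((1 : ℝ) / 2 * (1 / 2)) ^ j := mul_le_mul_of_nonneg_right (mul_le_mul hc (hC j) (norm_nonneg _) zero_le_one) (by positivity)
    _ = C * ((1 : ℝ) / 2) ^ j := by rw [one_mul, mul_assoc, ← mul_pow]; norm_num

/-- `‖Σ_{j≤M} binom(n,j)B_ja^j‖₂ ≤ C` (ultrametric). -/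
theorem norm_psum_le (M n : ℕ) : ‖psum a M n‖ ≤ C :=
  IsUltrametricDist.norm_sum_le_of_forall_le_of_nonneg (C_nonneg hC) fun j _ =>
    (norm_term_le hC ha n j).trans (mul_le_of_le_one_right (C_nonneg hC) (pow_le_one₀ (by norm_num) (by norm_num)))

/-- `‖binom(n+d,j)B_ja^j − binom(n,j)B_ja^j‖₂ ≤ C·‖d‖₂` (`j·2^{−j} ≤ 1`). -/
theorem norm_term_sub_le (n d j : ℕ) : ‖term a (n + d) j - term a n j‖ ≤ C * ‖(d : ℚ_[2])‖ := by
  have hC0 := C_nonneg hC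
  have h : term a (n + d) j - term a n j = ((((n + d).choose j : ℕ) : ℚ_[2]) - ((n.choose j : ℕ) : ℚ_[2])) * (bernTwo j * a ^ j) := by
    simp only [term]; ring
  have h2 : (2 : ℝ) ^ j * ((1 : ℝ) / 2 * (1 / 2)) ^ j = ((1 : ℝ) / 2) ^ j := by rw [← mul_pow]; norm_num
  rw [h, norm_mul, norm_mul, norm_pow, ha]
  calc ‖(((n + d).choose j : ℕ) : ℚ_[2]) - ((n.choose j : ℕ) : ℚ_[2])‖ * (‖bernTwo j‖ * ((1 : ℝ) / 2 * (1 / 2)) ^ j)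
      ≤ (j * ‖(d : ℚ_[2])‖) * ((C * 2 ^ j) * ((1 : ℝ) / 2 * (1 / 2)) ^ j) :=
        mul_le_mul (norm_choose_add_sub_choose_le n d j) (mul_le_mul_of_nonneg_right (hC j) (by positivity)) (by positivity) (by positivity)
    _ = ((j : ℝ) * ((1 : ℝ) / 2) ^ j) * (C * ‖(d : ℚ_[2])‖) := by rw [mul_assoc C, h2]; ring
    _ ≤ 1 * (C * ‖(d : ℚ_[2])‖) := mul_le_mul_of_nonneg_right (cast_mul_half_pow_le_one j) (by positivity)
    _ = C * ‖(d : ℚ_[2])‖ := one_mul _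

/-- `‖Σ_{j≤M}(binom(n+d,j) − binom(n,j))B_ja^j‖₂ ≤ C·‖d‖₂`. -/
theorem norm_psum_sub_le (M n d : ℕ) : ‖psum a M (n + d) - psum a M n‖ ≤ C * ‖(d : ℚ_[2])‖ := by
  rw [psum, psum, ← Finset.sum_sub_distrib]
  exact IsUltrametricDist.norm_sum_le_of_forall_le_of_nonneg (by have := C_nonneg hC; positivity) fun j _ => norm_term_sub_le hC ha n d j

end Bounds

/-- The main estimate, ordered form: for odd `n` and odd `n + d`, `‖β(1−(n+d)) − β(1−n)‖₂ ≤ 20C·‖d‖₂`. -/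
theorem norm_betaOneSub_sub_le {C : ℝ} (hC : ∀ n, ‖bernTwo n‖ ≤ C * 2 ^ n) {n d : ℕ} (hn : Odd n) (hm : Odd (n + d)) :
    ‖((betaOneSub (n + d) : ℚ) : ℚ_[2]) - ((betaOneSub n : ℚ) : ℚ_[2])‖ ≤ 20 * C * ‖(d : ℚ_[2])‖ := by
  have hC0 := C_nonneg hC
  have hn0 : n ≠ 0 := hn.pos.ne'
  have hm0 : n + d ≠ 0 := hm.pos.ne'
  have hnn : ‖(n : ℚ_[2])‖ = 1 := norm_natCast_of_odd hn
  have hmn : ‖((n + d : ℕ) : ℚ_[2])‖ = 1 := norm_natCast_of_odd hm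
  have h4 : ‖(4 : ℚ_[2])‖ = (1 : ℝ) / 2 * (1 / 2) := norm_four
  have h43 : ‖(4 / 3 : ℚ_[2])‖ = (1 : ℝ) / 2 * (1 / 2) := norm_four_div_three
  set A := psum 4 (n + d) (n + d)
  set A' := psum 4 (n + d) n
  set B := psum (4 / 3) (n + d) (n + d)
  set B' := psum (4 / 3) (n + d) n
  have eβm : ((betaOneSub (n + d) : ℚ) : ℚ_[2]) = -(4 * ((n + d : ℕ) : ℚ_[2]))⁻¹ * (A - 3 ^ (n + d) * B) := cast_betaOneSub hm0 le_rfl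
  have eβn : ((betaOneSub n : ℚ) : ℚ_[2]) = -(4 * (n : ℚ_[2]))⁻¹ * (A' - 3 ^ n * B') := cast_betaOneSub hn0 (Nat.le_add_right n d)
  have hA : ‖A‖ ≤ C := norm_psum_le hC h4 _ _
  have hB : ‖B‖ ≤ C := norm_psum_le hC h43 _ _
  have hB' : ‖B'‖ ≤ C := norm_psum_le hC h43 _ _
  have hAA : ‖A - A'‖ ≤ C * ‖(d : ℚ_[2])‖ := norm_psum_sub_le hC h4 _ _ _
  have hBB : ‖B - B'‖ ≤ C * ‖(d : ℚ_[2])‖ := norm_psum_sub_le hC h43 _ _ _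
  have h33 : ‖(3 : ℚ_[2]) ^ (n + d) - 3 ^ n‖ ≤ ‖(d : ℚ_[2])‖ := by
    rw [show (3 : ℚ_[2]) ^ (n + d) - 3 ^ n = 3 ^ n * (3 ^ d - 1) by ring, norm_mul, norm_pow, norm_three, one_pow, one_mul]
    exact norm_three_pow_sub_one_le d
  have h3n : ‖(3 : ℚ_[2]) ^ n‖ = 1 := by rw [norm_pow, norm_three, one_pow]
  have h3m : ‖(3 : ℚ_[2]) ^ (n + d)‖ = 1 := by rw [norm_pow, norm_three, one_pow]
  have hinv : ‖(4 * ((n + d : ℕ) : ℚ_[2]))⁻¹ - (4 * (n : ℚ_[2]))⁻¹‖ = ‖(d : ℚ_[2])‖ * 4 := by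
    have hn' : (n : ℚ_[2]) ≠ 0 := by exact_mod_cast hn0
    have hm' : ((n + d : ℕ) : ℚ_[2]) ≠ 0 := by exact_mod_cast hm0
    have e : (4 * ((n + d : ℕ) : ℚ_[2]))⁻¹ - (4 * (n : ℚ_[2]))⁻¹ = -(d : ℚ_[2]) * ((4 * ((n + d : ℕ) : ℚ_[2]))⁻¹ * (n : ℚ_[2])⁻¹) := by
      field_simp; push_cast; ring
    rw [e, norm_mul, norm_neg, norm_mul, norm_inv, norm_inv, norm_mul, h4, hmn, hnn]
    norm_num
  have hinvn : ‖(4 * (n : ℚ_[2]))⁻¹‖ = 4 := by rw [norm_inv, norm_mul, h4, hnn]; norm_num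
  have key : ((betaOneSub (n + d) : ℚ) : ℚ_[2]) - ((betaOneSub n : ℚ) : ℚ_[2]) =
      -((4 * ((n + d : ℕ) : ℚ_[2]))⁻¹ - (4 * (n : ℚ_[2]))⁻¹) * (A - 3 ^ (n + d) * B)
        - (4 * (n : ℚ_[2]))⁻¹ * ((A - A') - ((3 ^ (n + d) - 3 ^ n) * B + 3 ^ n * (B - B'))) := by
    rw [eβm, eβn]; ring
  have P1 : ‖-((4 * ((n + d : ℕ) : ℚ_[2]))⁻¹ - (4 * (n : ℚ_[2]))⁻¹) * (A - 3 ^ (n + d) * B)‖ ≤ 8 * C * ‖(d : ℚ_[2])‖ := by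
    rw [norm_mul, norm_neg, hinv]
    have hX : ‖A - 3 ^ (n + d) * B‖ ≤ C + C := (norm_sub_le _ _).trans (add_le_add hA (by rw [norm_mul, h3m, one_mul]; exact hB))
    calc ‖(d : ℚ_[2])‖ * 4 * ‖A - 3 ^ (n + d) * B‖ ≤ ‖(d : ℚ_[2])‖ * 4 * (C + C) := by gcongr
      _ = 8 * C * ‖(d : ℚ_[2])‖ := by ring
  have P2 : ‖(4 * (n : ℚ_[2]))⁻¹ * ((A - A') - ((3 ^ (n + d) - 3 ^ n) * B + 3 ^ n * (B - B')))‖ ≤ 12 * C * ‖(d : ℚ_[2])‖ := by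
    rw [norm_mul, hinvn]
    have hY : ‖(A - A') - ((3 ^ (n + d) - 3 ^ n) * B + 3 ^ n * (B - B'))‖ ≤ C * ‖(d : ℚ_[2])‖ + (‖(d : ℚ_[2])‖ * C + C * ‖(d : ℚ_[2])‖) := by
      refine (norm_sub_le _ _).trans (add_le_add hAA ((norm_add_le _ _).trans (add_le_add ?_ ?_)))
      · rw [norm_mul]; exact mul_le_mul h33 hB (norm_nonneg _) (norm_nonneg _)
      · rw [norm_mul, h3n, one_mul]; exact hBB
    calc 4 * ‖(A - A') - ((3 ^ (n + d) - 3 ^ n) * B + 3 ^ n * (B - B'))‖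
        ≤ 4 * (C * ‖(d : ℚ_[2])‖ + (‖(d : ℚ_[2])‖ * C + C * ‖(d : ℚ_[2])‖)) := by gcongr
      _ = 12 * C * ‖(d : ℚ_[2])‖ := by ring
  rw [key]; exact (norm_sub_le _ _).trans (by linarith)

/-- **Generalised Kummer congruences, Lipschitz form:** `‖β(1−m) − β(1−n)‖₂ ≤ K·‖m − n‖₂` for all odd `m, n ≥ 1`.
(The classical congruences `E_{m−1} ≡ E_{n−1} mod 2^a` for `m ≡ n mod 2^a` are the integer shadow of this.) -/
theorem betaOneSub_lipschitz : ∃ K : ℝ, 0 ≤ K ∧ ∀ m n : ℕ, Odd m → Odd n →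
    ‖((betaOneSub m : ℚ) : ℚ_[2]) - ((betaOneSub n : ℚ) : ℚ_[2])‖ ≤ K * ‖(m : ℚ_[2]) - (n : ℚ_[2])‖ := by
  obtain ⟨C, _, hC⟩ := exists_norm_bernTwo_le
  refine ⟨20 * C, by have := C_nonneg hC; positivity, fun m n hm hn => ?_⟩
  rcases le_total n m with h | h
  · obtain ⟨d, rfl⟩ := Nat.exists_eq_add_of_le h
    have hd : ((n + d : ℕ) : ℚ_[2]) - (n : ℚ_[2]) = (d : ℚ_[2]) := by push_cast; ring
    rw [hd]
    exact norm_betaOneSub_sub_le hC hn hm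
  · obtain ⟨d, rfl⟩ := Nat.exists_eq_add_of_le h
    have hd : (m : ℚ_[2]) - ((m + d : ℕ) : ℚ_[2]) = -(d : ℚ_[2]) := by push_cast; ring
    rw [hd, norm_neg, norm_sub_rev]
    exact norm_betaOneSub_sub_le hC hm hn

/-! ### The continuous interpolation on `ℤ₂` -/

/-- `β(1 − (2t+1)) = L(−2t, χ₋₄) ∈ ℚ ⊂ ℚ₂` for `t ∈ ℕ` — the values to be interpolated (`= ζ₂(−2t)`). -/
def betaOdd (t : ℕ) : ℚ_[2] := ((betaOneSub (2 * t + 1) : ℚ) : ℚ_[2])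

/-- `t ↦ L(−2t, χ₋₄)` is 2-adically Lipschitz on `ℕ`. -/
theorem betaOdd_lipschitz : ∃ K : ℝ, 0 ≤ K ∧ ∀ t u : ℕ, ‖betaOdd t - betaOdd u‖ ≤ K * ‖(t : ℚ_[2]) - (u : ℚ_[2])‖ := by
  obtain ⟨K, hK0, hK⟩ := betaOneSub_lipschitz
  refine ⟨K, hK0, fun t u => ?_⟩
  have h := hK (2 * t + 1) (2 * u + 1) (odd_two_mul_add_one t) (odd_two_mul_add_one u)
  have hc : ((2 * t + 1 : ℕ) : ℚ_[2]) - ((2 * u + 1 : ℕ) : ℚ_[2]) = 2 * ((t : ℚ_[2]) - (u : ℚ_[2])) := by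
    push_cast; ring
  rw [hc, norm_mul, norm_two_padic] at h
  refine h.trans ?_
  calc K * ((1 : ℝ) / 2 * ‖(t : ℚ_[2]) - (u : ℚ_[2])‖) ≤ K * (1 * ‖(t : ℚ_[2]) - (u : ℚ_[2])‖) := by gcongr; norm_num
    _ = K * ‖(t : ℚ_[2]) - (u : ℚ_[2])‖ := by rw [one_mul]

/-- `x mod 2^N ∈ ℕ` is `2^{−N}`-close to `x ∈ ℤ₂`. -/
theorem norm_appr_sub_le (x : ℤ_[2]) (N : ℕ) : ‖((x.appr N : ℕ) : ℚ_[2]) - (x : ℚ_[2])‖ ≤ ((1 : ℝ) / 2) ^ N := by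
  have h := (PadicInt.norm_le_pow_iff_mem_span_pow _ N).mpr (PadicInt.appr_spec N x)
  have e : ((2 : ℕ) : ℝ) ^ (-(N : ℤ)) = ((1 : ℝ) / 2) ^ N := by
    rw [zpow_neg, zpow_natCast, one_div, inv_pow, Nat.cast_ofNat]
  rw [e, PadicInt.norm_def, PadicInt.coe_sub, PadicInt.coe_natCast, norm_sub_rev] at h
  exact h

/-- The approximating sequence `N ↦ L(−2·(x mod 2^N), χ₋₄)`. -/
def apprSeq (x : ℤ_[2]) (N : ℕ) : ℚ_[2] := betaOdd (x.appr N)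

/-- `N ↦ L(−2·(x mod 2^N), χ₋₄)` is Cauchy in `ℚ₂` (geometric rate `2^{−N}`). -/
theorem cauchySeq_apprSeq (x : ℤ_[2]) : CauchySeq (apprSeq x) := by
  obtain ⟨K, hK0, hK⟩ := betaOdd_lipschitz
  refine cauchySeq_of_le_geometric ((1 : ℝ) / 2) (2 * K) (by norm_num) fun N => ?_
  rw [dist_eq_norm]
  have hx := norm_appr_sub_le x N
  have hx' := norm_appr_sub_le x (N + 1)
  have hp : 0 ≤ ((1 : ℝ) / 2) ^ N := by positivity
  have hd : ‖((x.appr N : ℕ) : ℚ_[2]) - ((x.appr (N + 1) : ℕ) : ℚ_[2])‖ ≤ ((1 : ℝ) / 2) ^ N + ((1 : ℝ) / 2) ^ (N + 1) := by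
    calc ‖((x.appr N : ℕ) : ℚ_[2]) - ((x.appr (N + 1) : ℕ) : ℚ_[2])‖
        = ‖(((x.appr N : ℕ) : ℚ_[2]) - (x : ℚ_[2])) - (((x.appr (N + 1) : ℕ) : ℚ_[2]) - (x : ℚ_[2]))‖ := by
          congr 1; ring
      _ ≤ _ := (norm_sub_le _ _).trans (add_le_add hx hx')
  calc ‖apprSeq x N - apprSeq x (N + 1)‖ ≤ K * ‖((x.appr N : ℕ) : ℚ_[2]) - ((x.appr (N + 1) : ℕ) : ℚ_[2])‖ := hK _ _
    _ ≤ K * (((1 : ℝ) / 2) ^ N + ((1 : ℝ) / 2) ^ (N + 1)) := by gcongr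
    _ ≤ 2 * K * ((1 : ℝ) / 2) ^ N := by rw [pow_succ]; nlinarith [mul_nonneg hK0 hp]

/-- **`L₂`, the Kubota–Leopoldt interpolation on `ℤ₂`** (dictionary: `LTwo t = ζ₂(−2t) = L₂(−2t, 𝟙)`, so `s = −2t` runs over `2ℤ₂`
and `t = −1` is `s = 2`): the limit of `L(−2·(x mod 2^N), χ₋₄)` as `N → ∞`. -/
def LTwo (x : ℤ_[2]) : ℚ_[2] := limUnder atTop (apprSeq x)

/-- `L(−2·(x mod 2^N), χ₋₄) → L₂(x)`. -/
theorem tendsto_apprSeq (x : ℤ_[2]) : Tendsto (apprSeq x) atTop (𝓝 (LTwo x)) :=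
  (cauchySeq_apprSeq x).tendsto_limUnder

/-- **Interpolation:** `L₂(−2t) = L(−2t, χ₋₄)` for `t ∈ ℕ`, i.e. `ζ₂(1−n) = L(1−n, χ₋₄) = −B_{n,χ₋₄}/n` for odd `n = 2t+1`. -/
theorem LTwo_natCast (t : ℕ) : LTwo t = betaOdd t := by
  obtain ⟨K, hK0, hK⟩ := betaOdd_lipschitz
  refine tendsto_nhds_unique (tendsto_apprSeq t) ?_
  rw [tendsto_iff_norm_sub_tendsto_zero]
  have h0 : Tendsto (fun N : ℕ => K * ((1 : ℝ) / 2) ^ N) atTop (𝓝 0) := by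
    simpa using (tendsto_pow_atTop_nhds_zero_of_lt_one (by norm_num) (by norm_num : ((1 : ℝ) / 2) < 1)).const_mul K
  refine squeeze_zero (fun _ => norm_nonneg _) (fun N => ?_) h0
  have ht := norm_appr_sub_le (t : ℤ_[2]) N
  rw [PadicInt.coe_natCast] at ht
  calc ‖apprSeq (t : ℤ_[2]) N - betaOdd t‖ ≤ K * ‖((((t : ℤ_[2]).appr N : ℕ) : ℚ_[2])) - (t : ℚ_[2])‖ := hK _ _
    _ ≤ K * ((1 : ℝ) / 2) ^ N := by gcongr

/-- `L₂` is 2-adically Lipschitz: `‖L₂(x) − L₂(y)‖₂ ≤ K·‖x − y‖₂`. -/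
theorem norm_LTwo_sub_le : ∃ K : ℝ, 0 ≤ K ∧ ∀ x y : ℤ_[2], ‖LTwo x - LTwo y‖ ≤ K * ‖x - y‖ := by
  obtain ⟨K, hK0, hK⟩ := betaOdd_lipschitz
  refine ⟨K, hK0, fun x y => ?_⟩
  have hxy : ‖x - y‖ = ‖(x : ℚ_[2]) - (y : ℚ_[2])‖ := by rw [PadicInt.norm_def, PadicInt.coe_sub]
  have hlim : Tendsto (fun N => ‖apprSeq x N - apprSeq y N‖) atTop (𝓝 ‖LTwo x - LTwo y‖) :=
    ((tendsto_apprSeq x).sub (tendsto_apprSeq y)).norm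
  have hbd : Tendsto (fun N : ℕ => K * (‖x - y‖ + 2 * ((1 : ℝ) / 2) ^ N)) atTop (𝓝 (K * (‖x - y‖ + 2 * 0))) :=
    (((tendsto_pow_atTop_nhds_zero_of_lt_one (by norm_num) (by norm_num : ((1 : ℝ) / 2) < 1)).const_mul 2).const_add
      ‖x - y‖).const_mul K
  rw [mul_zero, add_zero] at hbd
  refine le_of_tendsto_of_tendsto' hlim hbd fun N => ?_
  have hx := norm_appr_sub_le x N
  have hy := norm_appr_sub_le y N
  have h3 : ‖((x.appr N : ℕ) : ℚ_[2]) - ((y.appr N : ℕ) : ℚ_[2])‖ ≤ ‖x - y‖ + 2 * ((1 : ℝ) / 2) ^ N := by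
    rw [hxy]
    calc ‖((x.appr N : ℕ) : ℚ_[2]) - ((y.appr N : ℕ) : ℚ_[2])‖
        = ‖(((x.appr N : ℕ) : ℚ_[2]) - (x : ℚ_[2])) + ((x : ℚ_[2]) - (y : ℚ_[2]))
            - (((y.appr N : ℕ) : ℚ_[2]) - (y : ℚ_[2]))‖ := by congr 1; ring
      _ ≤ ‖((x.appr N : ℕ) : ℚ_[2]) - (x : ℚ_[2])‖ + ‖(x : ℚ_[2]) - (y : ℚ_[2])‖
            + ‖((y.appr N : ℕ) : ℚ_[2]) - (y : ℚ_[2])‖ := (norm_sub_le _ _).trans (by gcongr; exact norm_add_le _ _)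
      _ ≤ ((1 : ℝ) / 2) ^ N + ‖(x : ℚ_[2]) - (y : ℚ_[2])‖ + ((1 : ℝ) / 2) ^ N := by gcongr
      _ = ‖(x : ℚ_[2]) - (y : ℚ_[2])‖ + 2 * ((1 : ℝ) / 2) ^ N := by ring
  calc ‖apprSeq x N - apprSeq y N‖ ≤ K * ‖((x.appr N : ℕ) : ℚ_[2]) - ((y.appr N : ℕ) : ℚ_[2])‖ := hK _ _
    _ ≤ K * (‖x - y‖ + 2 * ((1 : ℝ) / 2) ^ N) := by gcongr

/-- **`L₂` is continuous on `ℤ₂`.** -/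
theorem continuous_LTwo : Continuous LTwo := by
  obtain ⟨K, hK0, hK⟩ := norm_LTwo_sub_le
  exact (LipschitzWith.of_dist_le_mul (K := ⟨K, hK0⟩) fun x y => by
    rw [dist_eq_norm, dist_eq_norm]; exact hK x y).continuous

/-- **Uniqueness:** a continuous function on `ℤ₂` agreeing with `L(−2t, χ₋₄)` on `t ∈ ℕ` is `L₂` (density of `ℕ` in `ℤ₂`). -/
theorem LTwo_unique {Z : ℤ_[2] → ℚ_[2]} (hc : Continuous Z) (h : ∀ t : ℕ, Z t = betaOdd t) : Z = LTwo :=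
  Continuous.ext_on PadicInt.denseRange_natCast hc continuous_LTwo fun x hx => by
    obtain ⟨t, rfl⟩ := hx
    rw [h, LTwo_natCast]

/-- `2^M − 1 → −1` in `ℤ₂`. -/
theorem tendsto_two_pow_sub_one : Tendsto (fun M : ℕ => ((2 ^ M - 1 : ℕ) : ℤ_[2])) atTop (𝓝 (-1)) := by
  rw [tendsto_iff_norm_sub_tendsto_zero]
  have h : ∀ M : ℕ, ‖((2 ^ M - 1 : ℕ) : ℤ_[2]) - (-1)‖ = (2 : ℝ)⁻¹ ^ M := fun M => by
    rw [sub_neg_eq_add, Nat.cast_sub Nat.one_le_two_pow, Nat.cast_one, sub_add_cancel, Nat.cast_pow, norm_pow,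
      PadicInt.norm_p, Nat.cast_ofNat]
  simp only [h]
  exact tendsto_pow_atTop_nhds_zero_of_lt_one (by norm_num) (by norm_num)

/-- **Kernel K5f — `ζ₂(2) = ξ`:** the continuous interpolation takes the value `ξ` at `t = −1`, i.e. at `s = 2`
(K5e: `L(2 − 2^{M+1}, χ₋₄) = L₂(2^M − 1) → ξ`, and `2^M − 1 → −1` in `ℤ₂`). -/
theorem LTwo_neg_one : LTwo (-1) = xi := by
  have h1 : Tendsto (fun M : ℕ => LTwo ((2 ^ M - 1 : ℕ) : ℤ_[2])) atTop (𝓝 (LTwo (-1))) :=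
    (continuous_LTwo.tendsto (-1)).comp tendsto_two_pow_sub_one
  have h2 : Tendsto (fun M : ℕ => LTwo ((2 ^ M - 1 : ℕ) : ℤ_[2])) atTop (𝓝 xi) := by
    have e : ∀ M : ℕ, LTwo ((2 ^ M - 1 : ℕ) : ℤ_[2]) = ((betaOneSub (2 ^ (M + 1) - 1) : ℚ) : ℚ_[2]) := fun M => by
      have hM : 2 * (2 ^ M - 1) + 1 = 2 ^ (M + 1) - 1 := by
        have := Nat.one_le_two_pow (n := M)
        rw [pow_succ]; omega
      rw [LTwo_natCast, betaOdd, hM]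
    simp only [e]
    exact tendsto_betaOneSub_xi.comp (tendsto_add_atTop_nat 1)
  exact tendsto_nhds_unique h1 h2

/-- **Kubota–Leopoldt at `p = 2`, `s ∈ 2ℤ₂`, with its value at `s = 2`:** there is EXACTLY ONE continuous `Z : ℤ₂ → ℚ₂` with
`Z(t) = L(−2t, χ₋₄)` for all `t ∈ ℕ` (namely `Z(t) = ζ₂(−2t)`), and every such `Z` has `Z(−1) = ξ`: **`ξ = ζ₂(2)`** with `ζ₂`
characterised — and here constructed — by its interpolation property. -/
theorem kubotaLeopoldt_two :
    (∃! Z : ℤ_[2] → ℚ_[2], Continuous Z ∧ ∀ t : ℕ, Z t = ((betaOneSub (2 * t + 1) : ℚ) : ℚ_[2])) ∧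
    ∀ Z : ℤ_[2] → ℚ_[2], Continuous Z → (∀ t : ℕ, Z t = ((betaOneSub (2 * t + 1) : ℚ) : ℚ_[2])) → Z (-1) = xi :=
  ⟨⟨LTwo, ⟨continuous_LTwo, fun t => LTwo_natCast t⟩, fun _ h => LTwo_unique h.1 h.2⟩,
    fun _ hc h => by rw [LTwo_unique hc h, LTwo_neg_one]⟩

end Summit.KontsevichZagierPeriods.Zeta5Search.CatalanTwoAdicKubotaLeopoldt

end
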